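import Mathlib
import HarnessLib
import Literature.Analysis.Fourier.AiryHardyIntegral

/-!
# Tails of the Airy–Hardy integral (Graham–Kolesnik, Lemmas 7.8–7.9), PROVED

Topic `Literature/Analysis/Fourier`. Graham–Kolesnik, *Van der Corput's Method of Exponential Sums*
(LMS Lecture Note Series 126, CUP 1991), §7.3, Lemmas 7.8 and 7.9 (pp. 63–64 of the copy read), the
two estimates for `∫ g(x) e(μx³ - hx/c) dx` away from the stationary range that make the `h`-sum in
the Poisson step of Lemma 7.16 (the cubic exponential sums of the Bombieri–Iwaniec method) converge:

* **Lemma 7.8.** "Let `g(x)` be the function whose graph is given below" — the trapezoid that is `0`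
  off `[N, N₁ + 1]`, rises with slope `1` on `[N, N + 1]`, equals `1` on `[N + 1, N₁]` and falls with
  slope `-1` on `[N₁, N₁ + 1]` (the figure is not in the text; the shape is forced by the integrals
  `I₂ = ∫_N^{N+1}`, `I₃ = ∫_{N₁}^{N₁+1}` of the proof of Lemma 7.9 and by the `O(1)` cost of replacing
  `∑_{N<n≤N₁}` by `∑ g(n)` in the proof of Lemma 7.16) — "Suppose that either `h < 2μcN²` or
  `h > 2μcN₁²`. Then `∫ g(x) e(μx³ - hx/c) dx ≪ c(μcN² + |h|)⁻¹`."
* **Lemma 7.9.** "If `|h| > 4μcN₁²` then `∫ g(x) e(μx³ - hx/c) dx ≪ (1 + μN²) c² h⁻²`."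

Both are PROVED here (`AiryHardy.GrahamKolesnik_lemma78`, `AiryHardy.GrahamKolesnik_lemma79`) with
explicit constants `7` and `100`, for the thresholds `h ≤ 2μcN²` or `h ≥ 4μc(N₁ + 1)²` (Lemma 7.8)
and `|h| ≥ 4μc(N₁ + 1)²` (Lemma 7.9). The printed thresholds `2μcN₁²`, `4μcN₁²` do not keep
`|3μcx² - h|` away from `0` on the whole support `[N, N₁ + 1]` of `g` when `N₁` is small (e.g.
`h = 4μcN₁²`, `x = N₁ + 1`, `N₁ = 6`); in the application (proof of Lemma 7.16) the lemmas are only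
needed for `h` outside a range of the form `[2μcN², K μcN₁²]`, the intermediate `h` being treated by
Lemma 7.7 (`AiryHardy.GrahamKolesnik_lemma77`), so the choice of thresholds affects constants only.

## Proof

Exact integration by parts on the three affine pieces of `g` (`integral_affine_mul_exp_eq`:
`∫ w e^{iF} = [w e^{iF}/(iF')] - ∫ w' e^{iF}/(iF') + ∫ w F'' e^{iF}/(iF'²)` for affine `w`); the six
boundary terms cancel since `g` is continuous and vanishes at `N`, `N₁ + 1`. For Lemma 7.8 the error
integrals are bounded by the first-derivative test (`norm_affine_error_le`, `∫ |F''|/F'² = |[1/F']|`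
when `F''` has a constant sign): `‖∫ g e^{iF}‖ ≤ 5/m` if `|F'| ≥ m` (`norm_integral_trap_le`), and
`|φ'| = 2π|3μx² - h/c| ≥ π(μcN² + |h|)/(4c)` on `[N, N₁ + 1]` under the hypothesis on `h`
(`abs_phase'_ge`). For Lemma 7.9 a second integration by parts on the two unit pieces
(`integral_exp_div_eq`: `∫ e^{iF}/(iF') = [e^{iF}/(iF')²] + ∫ 2iF''e^{iF}/(iF')³`) gives
`‖∫ g e^{iF}‖ ≤ 4/m² + 4K/m³ + (N₁ + 1 - N)K/m²` if `|F'| ≥ m`, `|F''| ≤ K`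
(`norm_integral_trap_le₂`); here `m = π|h|/(2c)`, `K = 36πμN`, and `μNc ≤ |h|/4`.

## Main results (namespace `Literature.Analysis.Fourier.AiryHardy`; everything PROVED)

* `trap` (the weight `g`), `trap_eq_left/mid/right`, `trap_eq_zero`, `continuous_trap`,
  `integral_trap_split`.
* `integral_affine_mul_exp_eq`, `norm_affine_error_le`, `norm_integral_trap_le` (first order);
  `integral_exp_div_eq`, `norm_integral_exp_div_le`, `norm_integral_affine_second_le`,
  `norm_integral_trap_le₂` (second order).
* `abs_phase'_ge`, `GrahamKolesnik_lemma78`, `GrahamKolesnik_lemma79`.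

## References

* S. W. Graham, G. Kolesnik, *Van der Corput's Method of Exponential Sums*, LMS Lecture Note Series
  126, Cambridge Univ. Press 1991, doi:10.1017/cbo9780511661976 — Lemmas 7.8, 7.9 (pp. 63–64),
  Lemma 3.1. [GrahamKolesnik1991]
-/

noncomputable section

open MeasureTheory Set intervalIntegral Complex Filter Topology
open scoped Real

namespace Literature.Analysis.Fourier

namespace AiryHardy

/-! ### Integration by parts with an affine amplitude -/

/-- **Exact integration by parts with an affine weight.** For `w(x) = αx + β` and a phase `F` with
`F' ≠ 0` on `[p, q]`:
`∫_p^q w e^{iF} = [w e^{iF}/(iF')]_p^q - ∫_p^q α e^{iF}/(iF') + ∫_p^q w F'' e^{iF}/(iF'²)`.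
[folklore] -/
theorem integral_affine_mul_exp_eq {F F' F'' : ℝ → ℝ} {p q α β : ℝ} (hpq : p ≤ q)
    (hF : ∀ x ∈ Icc p q, HasDerivAt F (F' x) x) (hF' : ∀ x ∈ Icc p q, HasDerivAt F' (F'' x) x)
    (hF''c : ContinuousOn F'' (Icc p q)) (hne : ∀ x ∈ Icc p q, F' x ≠ 0) :
    ∫ x in p..q, ((α * x + β : ℝ) : ℂ) * Complex.exp (I * F x) =
      ((α * q + β : ℝ) : ℂ) * Complex.exp (I * F q) / (I * F' q)
        - ((α * p + β : ℝ) : ℂ) * Complex.exp (I * F p) / (I * F' p)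
        - (∫ x in p..q, (α : ℂ) * Complex.exp (I * F x) / (I * F' x))
        + ∫ x in p..q, ((α * x + β : ℝ) : ℂ) * (F'' x : ℂ) * Complex.exp (I * F x) / (I * (F' x : ℂ) ^ 2) := by
  have huIcc : uIcc p q = Icc p q := uIcc_of_le hpq
  have hFc : ContinuousOn F (Icc p q) := fun x hx => (hF x hx).continuousAt.continuousWithinAt
  have hF'c : ContinuousOn F' (Icc p q) := fun x hx => (hF' x hx).continuousAt.continuousWithinAt
  have hEc : ContinuousOn (fun x => Complex.exp (I * F x)) (Icc p q) := continuousOn_exp_I_mul hF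
  have hne' : ∀ x ∈ Icc p q, (I * F' x : ℂ) ≠ 0 := fun x hx =>
    mul_ne_zero Complex.I_ne_zero (by exact_mod_cast hne x hx)
  -- `u = w e^{iF}/(iF')`
  obtain ⟨u, hu⟩ : ∃ u : ℝ → ℂ, u = fun x => ((α * x + β : ℝ) : ℂ) * Complex.exp (I * F x) / (I * F' x) :=
    ⟨_, rfl⟩
  obtain ⟨g1, hg1⟩ : ∃ g1 : ℝ → ℂ, g1 = fun x => ((α * x + β : ℝ) : ℂ) * Complex.exp (I * F x) :=
    ⟨_, rfl⟩
  obtain ⟨g2, hg2⟩ : ∃ g2 : ℝ → ℂ, g2 = fun x => (α : ℂ) * Complex.exp (I * F x) / (I * F' x) :=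
    ⟨_, rfl⟩
  obtain ⟨g3, hg3⟩ : ∃ g3 : ℝ → ℂ, g3 = fun x => ((α * x + β : ℝ) : ℂ) * (F'' x : ℂ) *
      Complex.exp (I * F x) / (I * (F' x : ℂ) ^ 2) := ⟨_, rfl⟩
  have hud : ∀ x ∈ Icc p q, HasDerivAt u (g1 x + g2 x - g3 x) x := by
    intro x hx
    have hw : HasDerivAt (fun x : ℝ => ((α * x + β : ℝ) : ℂ)) (α : ℂ) x := by
      have h1 : HasDerivAt (fun x : ℝ => α * x + β) (α * 1) x := ((hasDerivAt_id x).const_mul α).add_const β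
      simpa using h1.ofReal_comp
    have hE := hasDerivAt_exp_I_mul (hF x hx)
    have hD : HasDerivAt (fun x : ℝ => I * (F' x : ℂ)) (I * F'' x) x := by
      simpa using ((hF' x hx).ofReal_comp).const_mul I
    have h := (hw.mul hE).div hD (hne' x hx)
    rw [hu, hg1, hg2, hg3]
    refine h.congr_deriv ?_
    have hFne : (F' x : ℂ) ≠ 0 := by exact_mod_cast hne x hx
    simp only [Pi.mul_apply]
    field_simp
    ring
  -- continuity ⇒ integrability
  have hwc : ContinuousOn (fun x : ℝ => ((α * x + β : ℝ) : ℂ)) (Icc p q) :=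
    Complex.continuous_ofReal.comp_continuousOn (Continuous.continuousOn (by fun_prop))
  have hDc : ContinuousOn (fun x : ℝ => I * (F' x : ℂ)) (Icc p q) :=
    continuousOn_const.mul (Complex.continuous_ofReal.comp_continuousOn hF'c)
  have hg1c : ContinuousOn g1 (Icc p q) := by rw [hg1]; exact hwc.mul hEc
  have hg2c : ContinuousOn g2 (Icc p q) := by rw [hg2]; exact (continuousOn_const.mul hEc).div hDc hne'
  have hg3c : ContinuousOn g3 (Icc p q) := by
    rw [hg3]
    refine ((hwc.mul (Complex.continuous_ofReal.comp_continuousOn hF''c)).mul hEc).div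
      (continuousOn_const.mul ((Complex.continuous_ofReal.comp_continuousOn hF'c).pow 2)) ?_
    intro x hx
    exact mul_ne_zero Complex.I_ne_zero (pow_ne_zero _ (by exact_mod_cast hne x hx))
  have hi1 : IntervalIntegrable g1 volume p q := hg1c.intervalIntegrable_of_Icc hpq
  have hi2 : IntervalIntegrable g2 volume p q := hg2c.intervalIntegrable_of_Icc hpq
  have hi3 : IntervalIntegrable g3 volume p q := hg3c.intervalIntegrable_of_Icc hpq
  have hftc := intervalIntegral.integral_eq_sub_of_hasDerivAt
    (fun x hx => hud x (by rwa [huIcc] at hx)) ((hi1.add hi2).sub hi3)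
  rw [intervalIntegral.integral_sub (hi1.add hi2) hi3, intervalIntegral.integral_add hi1 hi2] at hftc
  have e : ∫ x in p..q, g1 x = (u q - u p) - (∫ x in p..q, g2 x) + ∫ x in p..q, g3 x := by
    rw [← hftc]; ring
  subst hu hg1 hg2 hg3
  exact e

/-- **Weighted first-derivative test for an affine weight**: if moreover `|F'| ≥ m > 0` on `[p, q]`,
`F''` has a constant sign there and `|w| ≤ W`, then the two error integrals satisfy
`‖∫ α e^{iF}/(iF')‖ ≤ |α|(q - p)/m` and `‖∫ w F'' e^{iF}/(iF'²)‖ ≤ W/m`. [folklore] -/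
theorem norm_affine_error_le {F F' F'' : ℝ → ℝ} {p q α β m W : ℝ} (hpq : p ≤ q) (hm : 0 < m)
    (hF' : ∀ x ∈ Icc p q, HasDerivAt F' (F'' x) x)
    (hF''c : ContinuousOn F'' (Icc p q))
    (hsign : (∀ x ∈ Icc p q, 0 ≤ F'' x) ∨ (∀ x ∈ Icc p q, F'' x ≤ 0))
    (hm' : ∀ x ∈ Icc p q, m ≤ |F' x|) (hW : ∀ x ∈ Icc p q, |α * x + β| ≤ W) :
    ‖∫ x in p..q, (α : ℂ) * Complex.exp (I * F x) / (I * F' x)‖ ≤ |α| * (q - p) / m ∧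
    ‖∫ x in p..q, ((α * x + β : ℝ) : ℂ) * (F'' x : ℂ) * Complex.exp (I * F x) / (I * (F' x : ℂ) ^ 2)‖
      ≤ W / m := by
  have hne : ∀ x ∈ Icc p q, F' x ≠ 0 := fun x hx h0 => by
    have := hm' x hx; rw [h0, abs_zero] at this; linarith
  have hW0 : 0 ≤ W := (abs_nonneg _).trans (hW p (left_mem_Icc.2 hpq))
  constructor
  · have h1 := intervalIntegral.norm_integral_le_of_norm_le_const (a := p) (b := q) (C := |α| / m)
      (f := fun x => (α : ℂ) * Complex.exp (I * F x) / (I * F' x)) (fun x hx => by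
        rw [uIoc_of_le hpq] at hx
        have hxI : x ∈ Icc p q := Ioc_subset_Icc_self hx
        rw [norm_div, norm_mul, norm_mul, Complex.norm_I, one_mul, norm_exp_I_mul_ofReal, mul_one,
          Complex.norm_real, Complex.norm_real, Real.norm_eq_abs, Real.norm_eq_abs]
        exact div_le_div_of_nonneg_left (abs_nonneg _) hm (hm' x hxI))
    rw [abs_of_nonneg (sub_nonneg.2 hpq)] at h1
    calc _ ≤ |α| / m * (q - p) := h1
      _ = |α| * (q - p) / m := by ring
  · -- `‖∫ w F'' e^{iF}/(iF'²)‖ ≤ W ∫ |F''|/F'² = W |1/F'(p) - 1/F'(q)| ≤ W/m`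
    have hF'c : ContinuousOn F' (Icc p q) := fun x hx => (hF' x hx).continuousAt.continuousWithinAt
    have hvd : ∀ x ∈ Icc p q, HasDerivAt (fun x => (F' x)⁻¹) (-(F'' x) / (F' x) ^ 2) x :=
      fun x hx => (hF' x hx).inv (hne x hx)
    have hv'c : ContinuousOn (fun x => -(F'' x) / (F' x) ^ 2) (Icc p q) :=
      hF''c.neg.div (hF'c.pow 2) fun x hx => pow_ne_zero _ (hne x hx)
    have hftc := intervalIntegral.integral_eq_sub_of_hasDerivAt
      (fun x hx => hvd x (by rwa [uIcc_of_le hpq] at hx)) (hv'c.intervalIntegrable_of_Icc hpq)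
    have h1 : ‖∫ x in p..q, ((α * x + β : ℝ) : ℂ) * (F'' x : ℂ) * Complex.exp (I * F x) /
        (I * (F' x : ℂ) ^ 2)‖ ≤ ∫ x in p..q, W * (|F'' x| / (F' x) ^ 2) := by
      refine intervalIntegral.norm_integral_le_of_norm_le hpq ?_ ?_
      · refine Filter.Eventually.of_forall fun x hx => ?_
        have hxI : x ∈ Icc p q := Ioc_subset_Icc_self hx
        rw [norm_div, norm_mul, norm_mul, norm_mul, Complex.norm_I, one_mul, norm_exp_I_mul_ofReal,
          mul_one, norm_pow, Complex.norm_real, Complex.norm_real, Complex.norm_real,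
          Real.norm_eq_abs, Real.norm_eq_abs, Real.norm_eq_abs, sq_abs, mul_div_assoc]
        exact mul_le_mul_of_nonneg_right (hW x hxI) (by positivity)
      · exact ((continuousOn_const.mul ((continuous_abs.comp_continuousOn hF''c).div (hF'c.pow 2)
          fun x hx => pow_ne_zero _ (hne x hx))).intervalIntegrable_of_Icc hpq)
    refine h1.trans ?_
    rw [intervalIntegral.integral_const_mul]
    have hI : ∫ x in p..q, |F'' x| / F' x ^ 2 = |(F' q)⁻¹ - (F' p)⁻¹| := by
      -- `∫ |F''|/F'² = |∫ F''/F'²| = |[-1/F']|` by the sign condition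
      rcases hsign with hs | hs
      · have he : ∫ x in p..q, |F'' x| / F' x ^ 2 = -(∫ x in p..q, -(F'' x) / F' x ^ 2) := by
          rw [← intervalIntegral.integral_neg]
          refine intervalIntegral.integral_congr fun x hx => ?_
          rw [uIcc_of_le hpq] at hx
          simp only [abs_of_nonneg (hs x hx), neg_div, neg_neg]
        have hnn : 0 ≤ ∫ x in p..q, |F'' x| / F' x ^ 2 :=
          intervalIntegral.integral_nonneg hpq fun x hx => by positivity
        rw [he, hftc] at hnn ⊢
        rw [abs_of_nonpos (by linarith)]
      · have he : ∫ x in p..q, |F'' x| / F' x ^ 2 = ∫ x in p..q, -(F'' x) / F' x ^ 2 := by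
          refine intervalIntegral.integral_congr fun x hx => ?_
          rw [uIcc_of_le hpq] at hx
          simp only [abs_of_nonpos (hs x hx), neg_div]
        have hnn : 0 ≤ ∫ x in p..q, |F'' x| / F' x ^ 2 :=
          intervalIntegral.integral_nonneg hpq fun x hx => by positivity
        rw [he, hftc] at hnn ⊢
        rw [abs_of_nonneg hnn]
    have hJ : |(F' q)⁻¹ - (F' p)⁻¹| ≤ 1 / m := by
      have hpI : p ∈ Icc p q := left_mem_Icc.2 hpq
      have hqI : q ∈ Icc p q := right_mem_Icc.2 hpq
      have hsame : (0 < F' p ∧ 0 < F' q) ∨ (F' p < 0 ∧ F' q < 0) := by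
        rcases lt_or_gt_of_ne (hne p hpI) with hp0 | hp0
        · rcases lt_or_gt_of_ne (hne q hqI) with hq0 | hq0
          · exact Or.inr ⟨hp0, hq0⟩
          · -- sign change would give a zero of `F'` by the intermediate value theorem
            exfalso
            have hivt := intermediate_value_Icc hpq hF'c
            have h0 : (0 : ℝ) ∈ Icc (F' p) (F' q) := ⟨hp0.le, hq0.le⟩
            obtain ⟨ξ, hξ, hξ0⟩ := hivt h0
            exact hne ξ hξ hξ0
        · rcases lt_or_gt_of_ne (hne q hqI) with hq0 | hq0
          · exfalso
            have hivt := intermediate_value_Icc' hpq hF'c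
            have h0 : (0 : ℝ) ∈ Icc (F' q) (F' p) := ⟨hq0.le, hp0.le⟩
            obtain ⟨ξ, hξ, hξ0⟩ := hivt h0
            exact hne ξ hξ hξ0
          · exact Or.inl ⟨hp0, hq0⟩
      have hmp := hm' p hpI
      have hmq := hm' q hqI
      rcases hsame with ⟨hp0, hq0⟩ | ⟨hp0, hq0⟩
      · rw [abs_of_pos hp0] at hmp; rw [abs_of_pos hq0] at hmq
        have h1 : (F' q)⁻¹ ≤ 1 / m := by rw [inv_eq_one_div]; exact one_div_le_one_div_of_le hm hmq
        have h2 : (F' p)⁻¹ ≤ 1 / m := by rw [inv_eq_one_div]; exact one_div_le_one_div_of_le hm hmp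
        have h3 : 0 < (F' q)⁻¹ := inv_pos.2 hq0
        have h4 : 0 < (F' p)⁻¹ := inv_pos.2 hp0
        rw [abs_le]; constructor <;> linarith
      · rw [abs_of_neg hp0] at hmp; rw [abs_of_neg hq0] at hmq
        have h1 : -(F' q)⁻¹ ≤ 1 / m := by
          rw [← inv_neg, inv_eq_one_div]; exact one_div_le_one_div_of_le hm hmq
        have h2 : -(F' p)⁻¹ ≤ 1 / m := by
          rw [← inv_neg, inv_eq_one_div]; exact one_div_le_one_div_of_le hm hmp
        have h3 : (F' q)⁻¹ < 0 := inv_lt_zero.2 hq0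
        have h4 : (F' p)⁻¹ < 0 := inv_lt_zero.2 hp0
        rw [abs_le]; constructor <;> linarith

    rw [hI]
    calc W * |(F' q)⁻¹ - (F' p)⁻¹| ≤ W * (1 / m) := mul_le_mul_of_nonneg_left hJ hW0
      _ = W / m := by ring

/-! ### The trapezoid weight of Graham–Kolesnik's Lemmas 7.8–7.9 -/

/-- The trapezoid weight `g` of Graham–Kolesnik's Lemma 7.8 (the figure on p. 63): `0` off
`[N, N₁ + 1]`, rising with slope `1` on `[N, N + 1]`, equal to `1` on `[N + 1, N₁]`, falling with
slope `-1` on `[N₁, N₁ + 1]`. [cite: GrahamKolesnik1991, Lemma 7.8 (the function g)] -/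
def trap (N N₁ x : ℝ) : ℝ := max 0 (min (min (x - N) (N₁ + 1 - x)) 1)

/-- On `[N, N + 1]` the weight is `x - N`. [folklore] -/
theorem trap_eq_left {N N₁ x : ℝ} (hN : N + 1 ≤ N₁) (hx : x ∈ Icc N (N + 1)) : trap N N₁ x = x - N := by
  unfold trap
  rw [min_eq_left (by linarith [hx.2] : x - N ≤ N₁ + 1 - x), min_eq_left (by linarith [hx.2]),
    max_eq_right (by linarith [hx.1])]

/-- On `[N + 1, N₁]` the weight is `1`. [folklore] -/
theorem trap_eq_mid {N N₁ x : ℝ} (hx : x ∈ Icc (N + 1) N₁) : trap N N₁ x = 1 := by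
  unfold trap
  rw [min_eq_right (le_min (by linarith [hx.1]) (by linarith [hx.2])), max_eq_right zero_le_one]

/-- On `[N₁, N₁ + 1]` the weight is `N₁ + 1 - x`. [folklore] -/
theorem trap_eq_right {N N₁ x : ℝ} (hN : N + 1 ≤ N₁) (hx : x ∈ Icc N₁ (N₁ + 1)) :
    trap N N₁ x = N₁ + 1 - x := by
  unfold trap
  rw [min_eq_right (by linarith [hx.1] : N₁ + 1 - x ≤ x - N), min_eq_left (by linarith [hx.1]),
    max_eq_right (by linarith [hx.2])]

/-- `g ≥ 0`. [folklore] -/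
theorem trap_nonneg (N N₁ x : ℝ) : 0 ≤ trap N N₁ x := le_max_left _ _

/-- `g ≤ 1`. [folklore] -/
theorem trap_le_one (N N₁ x : ℝ) : trap N N₁ x ≤ 1 :=
  max_le zero_le_one (min_le_right _ _)

/-- `g = 0` off `(N, N₁ + 1)`. [folklore] -/
theorem trap_eq_zero {N N₁ x : ℝ} (hx : x ≤ N ∨ N₁ + 1 ≤ x) : trap N N₁ x = 0 := by
  unfold trap
  refine max_eq_left (le_trans (min_le_left _ _) ?_)
  rcases hx with h | h
  · exact (min_le_left _ _).trans (by linarith)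
  · exact (min_le_right _ _).trans (by linarith)

/-- `trap` is continuous. [folklore] -/
theorem continuous_trap (N N₁ : ℝ) : Continuous (trap N N₁) := by
  unfold trap; fun_prop

/-- Splitting `∫_N^{N₁+1} g e^{iF}` into the three affine pieces. [folklore] -/
theorem integral_trap_split {F F' : ℝ → ℝ} {N N₁ : ℝ} (hN : N + 1 ≤ N₁)
    (hF : ∀ x ∈ Icc N (N₁ + 1), HasDerivAt F (F' x) x) :
    ∫ x in N..(N₁ + 1), (trap N N₁ x : ℂ) * Complex.exp (I * F x) =
      (∫ x in N..(N + 1), ((1 * x + -N : ℝ) : ℂ) * Complex.exp (I * F x))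
      + (∫ x in (N + 1)..N₁, ((0 * x + 1 : ℝ) : ℂ) * Complex.exp (I * F x))
      + ∫ x in N₁..(N₁ + 1), ((-1 * x + (N₁ + 1) : ℝ) : ℂ) * Complex.exp (I * F x) := by
  have hEc : ContinuousOn (fun x => Complex.exp (I * F x)) (Icc N (N₁ + 1)) := continuousOn_exp_I_mul hF
  have hgc : ContinuousOn (fun x => (trap N N₁ x : ℂ) * Complex.exp (I * F x)) (Icc N (N₁ + 1)) :=
    (Complex.continuous_ofReal.comp (continuous_trap N N₁)).continuousOn.mul hEc
  have hi : ∀ p ∈ Icc N (N₁ + 1), ∀ q ∈ Icc N (N₁ + 1), IntervalIntegrable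
      (fun x => (trap N N₁ x : ℂ) * Complex.exp (I * F x)) volume p q :=
    fun p hp q hq => (hgc.mono (uIcc_subset_Icc hp hq)).intervalIntegrable
  have h1I : N ∈ Icc N (N₁ + 1) := left_mem_Icc.2 (by linarith)
  have h2I : N + 1 ∈ Icc N (N₁ + 1) := ⟨by linarith, by linarith⟩
  have h3I : N₁ ∈ Icc N (N₁ + 1) := ⟨by linarith, by linarith⟩
  have h4I : N₁ + 1 ∈ Icc N (N₁ + 1) := right_mem_Icc.2 (by linarith)
  have h1 := intervalIntegral.integral_add_adjacent_intervals (hi N h1I (N + 1) h2I) (hi (N + 1) h2I (N₁ + 1) h4I)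
  have h2 := intervalIntegral.integral_add_adjacent_intervals (hi (N + 1) h2I N₁ h3I) (hi N₁ h3I (N₁ + 1) h4I)
  have hp1 : ∫ x in N..(N + 1), (trap N N₁ x : ℂ) * Complex.exp (I * F x) =
      ∫ x in N..(N + 1), ((1 * x + -N : ℝ) : ℂ) * Complex.exp (I * F x) := by
    refine intervalIntegral.integral_congr fun x hx => ?_
    rw [uIcc_of_le (by linarith)] at hx
    simp only [trap_eq_left hN hx]; push_cast; ring
  have hp2 : ∫ x in (N + 1)..N₁, (trap N N₁ x : ℂ) * Complex.exp (I * F x) =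
      ∫ x in (N + 1)..N₁, ((0 * x + 1 : ℝ) : ℂ) * Complex.exp (I * F x) := by
    refine intervalIntegral.integral_congr fun x hx => ?_
    rw [uIcc_of_le hN] at hx
    simp only [trap_eq_mid hx]; push_cast; ring
  have hp3 : ∫ x in N₁..(N₁ + 1), (trap N N₁ x : ℂ) * Complex.exp (I * F x) =
      ∫ x in N₁..(N₁ + 1), ((-1 * x + (N₁ + 1) : ℝ) : ℂ) * Complex.exp (I * F x) := by
    refine intervalIntegral.integral_congr fun x hx => ?_
    rw [uIcc_of_le (by linarith)] at hx
    simp only [trap_eq_right hN hx]; push_cast; ring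
  rw [← h1, ← h2, hp1, hp2, hp3]
  ring

/-- **First-order bound** (the mechanism of Graham–Kolesnik's Lemma 7.8): if `|F'| ≥ m > 0` and `F''`
has a constant sign on `[N, N₁ + 1]` (`N + 1 ≤ N₁`), then `‖∫_N^{N₁+1} g e^{iF}‖ ≤ 5/m`: after the
exact integration by parts on the three pieces the boundary terms cancel (`g` is continuous and
vanishes at `N`, `N₁ + 1`). [cite: GrahamKolesnik1991, Lemma 7.8, proof] -/
theorem norm_integral_trap_le {F F' F'' : ℝ → ℝ} {N N₁ m : ℝ} (hN : N + 1 ≤ N₁) (hm : 0 < m)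
    (hF : ∀ x ∈ Icc N (N₁ + 1), HasDerivAt F (F' x) x)
    (hF' : ∀ x ∈ Icc N (N₁ + 1), HasDerivAt F' (F'' x) x) (hF''c : ContinuousOn F'' (Icc N (N₁ + 1)))
    (hsign : (∀ x ∈ Icc N (N₁ + 1), 0 ≤ F'' x) ∨ (∀ x ∈ Icc N (N₁ + 1), F'' x ≤ 0))
    (hm' : ∀ x ∈ Icc N (N₁ + 1), m ≤ |F' x|) :
    ‖∫ x in N..(N₁ + 1), (trap N N₁ x : ℂ) * Complex.exp (I * F x)‖ ≤ 5 / m := by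
  have hne : ∀ x ∈ Icc N (N₁ + 1), F' x ≠ 0 := fun x hx h0 => by
    have := hm' x hx; rw [h0, abs_zero] at this; linarith
  -- restrictions to the pieces
  have hs1 : Icc N (N + 1) ⊆ Icc N (N₁ + 1) := Icc_subset_Icc le_rfl (by linarith)
  have hs2 : Icc (N + 1) N₁ ⊆ Icc N (N₁ + 1) := Icc_subset_Icc (by linarith) (by linarith)
  have hs3 : Icc N₁ (N₁ + 1) ⊆ Icc N (N₁ + 1) := Icc_subset_Icc (by linarith) le_rfl
  have hsign1 : (∀ x ∈ Icc N (N + 1), 0 ≤ F'' x) ∨ (∀ x ∈ Icc N (N + 1), F'' x ≤ 0) :=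
    hsign.imp (fun h x hx => h x (hs1 hx)) (fun h x hx => h x (hs1 hx))
  have hsign2 : (∀ x ∈ Icc (N + 1) N₁, 0 ≤ F'' x) ∨ (∀ x ∈ Icc (N + 1) N₁, F'' x ≤ 0) :=
    hsign.imp (fun h x hx => h x (hs2 hx)) (fun h x hx => h x (hs2 hx))
  have hsign3 : (∀ x ∈ Icc N₁ (N₁ + 1), 0 ≤ F'' x) ∨ (∀ x ∈ Icc N₁ (N₁ + 1), F'' x ≤ 0) :=
    hsign.imp (fun h x hx => h x (hs3 hx)) (fun h x hx => h x (hs3 hx))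
  rw [integral_trap_split hN hF,
    integral_affine_mul_exp_eq (α := 1) (β := -N) (by linarith) (fun x hx => hF x (hs1 hx))
      (fun x hx => hF' x (hs1 hx)) (hF''c.mono hs1) (fun x hx => hne x (hs1 hx)),
    integral_affine_mul_exp_eq (α := 0) (β := 1) hN (fun x hx => hF x (hs2 hx))
      (fun x hx => hF' x (hs2 hx)) (hF''c.mono hs2) (fun x hx => hne x (hs2 hx)),
    integral_affine_mul_exp_eq (α := -1) (β := N₁ + 1) (by linarith) (fun x hx => hF x (hs3 hx))
      (fun x hx => hF' x (hs3 hx)) (hF''c.mono hs3) (fun x hx => hne x (hs3 hx))]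
  obtain ⟨e21, e31⟩ := norm_affine_error_le (F := F) (α := 1) (β := -N) (W := 1) (by linarith) hm
    (fun x hx => hF' x (hs1 hx)) (hF''c.mono hs1) hsign1 (fun x hx => hm' x (hs1 hx))
    (fun x hx => by rw [abs_le]; constructor <;> linarith [hx.1, hx.2])
  obtain ⟨e22, e32⟩ := norm_affine_error_le (F := F) (α := 0) (β := 1) (W := 1) hN hm
    (fun x hx => hF' x (hs2 hx)) (hF''c.mono hs2) hsign2 (fun x hx => hm' x (hs2 hx))
    (fun x hx => by norm_num)
  obtain ⟨e23, e33⟩ := norm_affine_error_le (F := F) (α := -1) (β := N₁ + 1) (W := 1) (by linarith) hm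
    (fun x hx => hF' x (hs3 hx)) (hF''c.mono hs3) hsign3 (fun x hx => hm' x (hs3 hx))
    (fun x hx => by rw [abs_le]; constructor <;> linarith [hx.1, hx.2])
  -- the boundary terms cancel
  have hb : ((1 * (N + 1) + -N : ℝ) : ℂ) * Complex.exp (I * F (N + 1)) / (I * F' (N + 1))
      - ((1 * N + -N : ℝ) : ℂ) * Complex.exp (I * F N) / (I * F' N)
      + (((0 * N₁ + 1 : ℝ) : ℂ) * Complex.exp (I * F N₁) / (I * F' N₁)
      - ((0 * (N + 1) + 1 : ℝ) : ℂ) * Complex.exp (I * F (N + 1)) / (I * F' (N + 1)))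
      + (((-1 * (N₁ + 1) + (N₁ + 1) : ℝ) : ℂ) * Complex.exp (I * F (N₁ + 1)) / (I * F' (N₁ + 1))
      - ((-1 * N₁ + (N₁ + 1) : ℝ) : ℂ) * Complex.exp (I * F N₁) / (I * F' N₁)) = 0 := by
    push_cast; ring
  -- collect
  have key : ∀ (B₁ B₂ B₃ E₂₁ E₂₂ E₂₃ E₃₁ E₃₂ E₃₃ : ℂ), B₁ + B₂ + B₃ = 0 →
      ‖(B₁ - E₂₁ + E₃₁) + (B₂ - E₂₂ + E₃₂) + (B₃ - E₂₃ + E₃₃)‖ ≤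
        ‖E₂₁‖ + ‖E₂₂‖ + ‖E₂₃‖ + ‖E₃₁‖ + ‖E₃₂‖ + ‖E₃₃‖ := by
    intro B₁ B₂ B₃ E₂₁ E₂₂ E₂₃ E₃₁ E₃₂ E₃₃ h
    have : (B₁ - E₂₁ + E₃₁) + (B₂ - E₂₂ + E₃₂) + (B₃ - E₂₃ + E₃₃) =
        (E₃₁ + E₃₂ + E₃₃) - (E₂₁ + E₂₂ + E₂₃) := by linear_combination h
    rw [this]
    refine (norm_sub_le _ _).trans ?_
    have h1 := norm_add₃_le (a := E₃₁) (b := E₃₂) (c := E₃₃)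
    have h2 := norm_add₃_le (a := E₂₁) (b := E₂₂) (c := E₂₃)
    linarith
  refine (key _ _ _ _ _ _ _ _ _ hb).trans ?_
  have r1 : |(1 : ℝ)| * (N + 1 - N) / m = 1 / m := by rw [abs_one]; ring
  have r2 : |(0 : ℝ)| * (N₁ - (N + 1)) / m = 0 := by rw [abs_zero]; ring
  have r3 : |(-1 : ℝ)| * (N₁ + 1 - N₁) / m = 1 / m := by rw [abs_neg, abs_one]; ring
  rw [r1] at e21
  rw [r2] at e22
  rw [r3] at e23
  have h5 : (5 : ℝ) / m = 1 / m + 0 + 1 / m + (1 / m + 1 / m + 1 / m) := by ring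
  rw [h5]
  linarith [e21, e22, e23, e31, e32, e33]


/-! ### Second-order pieces (the mechanism of Graham–Kolesnik's Lemma 7.9) -/

/-- **A second integration by parts**: for `F' ≠ 0` on `[p, q]`,
`∫_p^q e^{iF}/(iF') = [e^{iF}/(iF')²]_p^q + ∫_p^q 2iF'' e^{iF}/(iF')³`. [folklore] -/
theorem integral_exp_div_eq {F F' F'' : ℝ → ℝ} {p q : ℝ} (hpq : p ≤ q)
    (hF : ∀ x ∈ Icc p q, HasDerivAt F (F' x) x) (hF' : ∀ x ∈ Icc p q, HasDerivAt F' (F'' x) x)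
    (hF''c : ContinuousOn F'' (Icc p q)) (hne : ∀ x ∈ Icc p q, F' x ≠ 0) :
    ∫ x in p..q, Complex.exp (I * F x) / (I * F' x) =
      Complex.exp (I * F q) / (I * F' q) ^ 2 - Complex.exp (I * F p) / (I * F' p) ^ 2
        + ∫ x in p..q, 2 * (I * F'' x) * Complex.exp (I * F x) / (I * F' x) ^ 3 := by
  have huIcc : uIcc p q = Icc p q := uIcc_of_le hpq
  have hF'c : ContinuousOn F' (Icc p q) := fun x hx => (hF' x hx).continuousAt.continuousWithinAt
  have hEc : ContinuousOn (fun x => Complex.exp (I * F x)) (Icc p q) := continuousOn_exp_I_mul hF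
  have hne' : ∀ x ∈ Icc p q, (I * F' x : ℂ) ≠ 0 := fun x hx =>
    mul_ne_zero Complex.I_ne_zero (by exact_mod_cast hne x hx)
  obtain ⟨G, hG⟩ : ∃ G : ℝ → ℂ, G = fun x => Complex.exp (I * F x) / ((I * F' x) * (I * F' x)) := ⟨_, rfl⟩
  obtain ⟨g1, hg1⟩ : ∃ g1 : ℝ → ℂ, g1 = fun x => Complex.exp (I * F x) / (I * F' x) := ⟨_, rfl⟩
  obtain ⟨g2, hg2⟩ : ∃ g2 : ℝ → ℂ, g2 = fun x => 2 * (I * F'' x) * Complex.exp (I * F x) / (I * F' x) ^ 3 :=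
    ⟨_, rfl⟩
  have hGd : ∀ x ∈ Icc p q, HasDerivAt G (g1 x - g2 x) x := by
    intro x hx
    have hE := hasDerivAt_exp_I_mul (hF x hx)
    have h1 : HasDerivAt (fun x : ℝ => I * (F' x : ℂ)) (I * F'' x) x := by
      simpa using ((hF' x hx).ofReal_comp).const_mul I
    have hD : HasDerivAt (fun x : ℝ => (I * (F' x : ℂ)) * (I * (F' x : ℂ)))
        (I * F'' x * (I * F' x) + I * F' x * (I * F'' x)) x := h1.mul h1
    have h := hE.div hD (mul_ne_zero (hne' x hx) (hne' x hx))
    rw [hG, hg1, hg2]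
    refine h.congr_deriv ?_
    have hFne : (F' x : ℂ) ≠ 0 := by exact_mod_cast hne x hx
    field_simp
    ring
  have hDc : ContinuousOn (fun x : ℝ => I * (F' x : ℂ)) (Icc p q) :=
    continuousOn_const.mul (Complex.continuous_ofReal.comp_continuousOn hF'c)
  have hg1c : ContinuousOn g1 (Icc p q) := by rw [hg1]; exact hEc.div hDc hne'
  have hg2c : ContinuousOn g2 (Icc p q) := by
    rw [hg2]
    refine ((continuousOn_const.mul (continuousOn_const.mul
      (Complex.continuous_ofReal.comp_continuousOn hF''c))).mul hEc).div (hDc.pow 3) ?_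
    exact fun x hx => pow_ne_zero _ (hne' x hx)
  have hi1 : IntervalIntegrable g1 volume p q := hg1c.intervalIntegrable_of_Icc hpq
  have hi2 : IntervalIntegrable g2 volume p q := hg2c.intervalIntegrable_of_Icc hpq
  have hftc := intervalIntegral.integral_eq_sub_of_hasDerivAt
    (fun x hx => hGd x (by rwa [huIcc] at hx)) (hi1.sub hi2)
  rw [intervalIntegral.integral_sub hi1 hi2] at hftc
  have e : ∫ x in p..q, g1 x = (G q - G p) + ∫ x in p..q, g2 x := by rw [← hftc]; ring
  subst hG hg1 hg2
  rw [sq, sq]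
  exact e

/-- The second-order bound on a piece of length `≤ 1`: if `|F'| ≥ m > 0` and `|F''| ≤ K` on `[p, q]`,
`q - p ≤ 1`, then `‖∫_p^q e^{iF}/(iF')‖ ≤ 2/m² + 2K/m³`. [cite: GrahamKolesnik1991, Lemma 7.9, proof (I₂, I₃)] -/
theorem norm_integral_exp_div_le {F F' F'' : ℝ → ℝ} {p q m K : ℝ} (hpq : p ≤ q) (hqp : q - p ≤ 1)
    (hm : 0 < m) (hF : ∀ x ∈ Icc p q, HasDerivAt F (F' x) x)
    (hF' : ∀ x ∈ Icc p q, HasDerivAt F' (F'' x) x) (hF''c : ContinuousOn F'' (Icc p q))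
    (hm' : ∀ x ∈ Icc p q, m ≤ |F' x|) (hK : ∀ x ∈ Icc p q, |F'' x| ≤ K) :
    ‖∫ x in p..q, Complex.exp (I * F x) / (I * F' x)‖ ≤ 2 / m ^ 2 + 2 * K / m ^ 3 := by
  have hne : ∀ x ∈ Icc p q, F' x ≠ 0 := fun x hx h0 => by
    have := hm' x hx; rw [h0, abs_zero] at this; linarith
  have hK0 : 0 ≤ K := (abs_nonneg _).trans (hK p (left_mem_Icc.2 hpq))
  rw [integral_exp_div_eq hpq hF hF' hF''c hne]
  have hbd : ∀ x ∈ Icc p q, ‖Complex.exp (I * F x) / (I * F' x) ^ 2‖ ≤ 1 / m ^ 2 := by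
    intro x hx
    rw [norm_div, norm_exp_I_mul_ofReal, norm_pow, norm_mul, Complex.norm_I, one_mul, Complex.norm_real,
      Real.norm_eq_abs]
    exact one_div_le_one_div_of_le (by positivity) (pow_le_pow_left₀ hm.le (hm' x hx) 2)
  have hint : ‖∫ x in p..q, 2 * (I * F'' x) * Complex.exp (I * F x) / (I * F' x) ^ 3‖ ≤ 2 * K / m ^ 3 := by
    have h1 := intervalIntegral.norm_integral_le_of_norm_le_const (a := p) (b := q) (C := 2 * K / m ^ 3)
      (f := fun x => 2 * (I * F'' x) * Complex.exp (I * F x) / (I * F' x) ^ 3) (fun x hx => by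
        rw [uIoc_of_le hpq] at hx
        have hxI : x ∈ Icc p q := Ioc_subset_Icc_self hx
        rw [norm_div, norm_mul, norm_mul, norm_mul, Complex.norm_I, one_mul, norm_exp_I_mul_ofReal,
          mul_one, norm_pow, norm_mul, Complex.norm_I, one_mul, Complex.norm_real, Complex.norm_real,
          Real.norm_eq_abs, Real.norm_eq_abs, Complex.norm_two]
        rw [div_le_div_iff₀ (pow_pos (hm.trans_le (hm' x hxI)) 3) (by positivity)]
        have h3 : m ^ 3 ≤ |F' x| ^ 3 := pow_le_pow_left₀ hm.le (hm' x hxI) 3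
        have h4 := mul_le_mul (hK x hxI) h3 (by positivity) hK0
        nlinarith [h4])
    rw [abs_of_nonneg (sub_nonneg.2 hpq)] at h1
    refine h1.trans ?_
    calc 2 * K / m ^ 3 * (q - p) ≤ 2 * K / m ^ 3 * 1 := by gcongr
      _ = 2 * K / m ^ 3 := mul_one _
  calc ‖Complex.exp (I * F q) / (I * F' q) ^ 2 - Complex.exp (I * F p) / (I * F' p) ^ 2
        + ∫ x in p..q, 2 * (I * F'' x) * Complex.exp (I * F x) / (I * F' x) ^ 3‖
      ≤ ‖Complex.exp (I * F q) / (I * F' q) ^ 2‖ + ‖Complex.exp (I * F p) / (I * F' p) ^ 2‖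
        + ‖∫ x in p..q, 2 * (I * F'' x) * Complex.exp (I * F x) / (I * F' x) ^ 3‖ := by
        refine (norm_add_le _ _).trans ?_
        gcongr
        exact norm_sub_le _ _
    _ ≤ 1 / m ^ 2 + 1 / m ^ 2 + 2 * K / m ^ 3 :=
        add_le_add (add_le_add (hbd q (right_mem_Icc.2 hpq)) (hbd p (left_mem_Icc.2 hpq))) hint
    _ = 2 / m ^ 2 + 2 * K / m ^ 3 := by ring

/-- Pointwise bound for the piece `w F'' e^{iF}/(iF'²)`: `≤ W K/m²`, hence the integral over `[p, q]` is
`≤ (q - p) W K/m²`. [folklore] -/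
theorem norm_integral_affine_second_le {F F' F'' : ℝ → ℝ} {p q α β m K W : ℝ} (hpq : p ≤ q)
    (hm : 0 < m) (hm' : ∀ x ∈ Icc p q, m ≤ |F' x|) (hK : ∀ x ∈ Icc p q, |F'' x| ≤ K)
    (hW : ∀ x ∈ Icc p q, |α * x + β| ≤ W) :
    ‖∫ x in p..q, ((α * x + β : ℝ) : ℂ) * (F'' x : ℂ) * Complex.exp (I * F x) / (I * (F' x : ℂ) ^ 2)‖
      ≤ (q - p) * (W * K / m ^ 2) := by
  have hW0 : 0 ≤ W := (abs_nonneg _).trans (hW p (left_mem_Icc.2 hpq))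
  have h1 := intervalIntegral.norm_integral_le_of_norm_le_const (a := p) (b := q) (C := W * K / m ^ 2)
    (f := fun x => ((α * x + β : ℝ) : ℂ) * (F'' x : ℂ) * Complex.exp (I * F x) / (I * (F' x : ℂ) ^ 2))
    (fun x hx => by
      rw [uIoc_of_le hpq] at hx
      have hxI : x ∈ Icc p q := Ioc_subset_Icc_self hx
      rw [norm_div, norm_mul, norm_mul, norm_mul, Complex.norm_I, one_mul, norm_exp_I_mul_ofReal,
        mul_one, norm_pow, Complex.norm_real, Complex.norm_real, Complex.norm_real,
        Real.norm_eq_abs, Real.norm_eq_abs, Real.norm_eq_abs]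
      rw [div_le_div_iff₀ (pow_pos (hm.trans_le (hm' x hxI)) 2) (by positivity)]
      have h2 : m ^ 2 ≤ |F' x| ^ 2 := pow_le_pow_left₀ hm.le (hm' x hxI) 2
      have h3 := mul_le_mul (hW x hxI) (hK x hxI) (abs_nonneg _) hW0
      have hK0 : 0 ≤ W * K := le_trans (mul_nonneg (abs_nonneg _) (abs_nonneg _)) h3
      nlinarith)
  rwa [abs_of_nonneg (sub_nonneg.2 hpq), mul_comm] at h1

/-- **Second-order bound** (the mechanism of Graham–Kolesnik's Lemma 7.9): if `|F'| ≥ m > 0` and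
`|F''| ≤ K` on `[N, N₁ + 1]` (`N + 1 ≤ N₁`), then
`‖∫_N^{N₁+1} g e^{iF}‖ ≤ 4/m² + 4K/m³ + (N₁ + 1 - N) K/m²`.
[cite: GrahamKolesnik1991, Lemma 7.9, proof] -/
theorem norm_integral_trap_le₂ {F F' F'' : ℝ → ℝ} {N N₁ m K : ℝ} (hN : N + 1 ≤ N₁) (hm : 0 < m)
    (hF : ∀ x ∈ Icc N (N₁ + 1), HasDerivAt F (F' x) x)
    (hF' : ∀ x ∈ Icc N (N₁ + 1), HasDerivAt F' (F'' x) x) (hF''c : ContinuousOn F'' (Icc N (N₁ + 1)))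
    (hm' : ∀ x ∈ Icc N (N₁ + 1), m ≤ |F' x|) (hK : ∀ x ∈ Icc N (N₁ + 1), |F'' x| ≤ K) :
    ‖∫ x in N..(N₁ + 1), (trap N N₁ x : ℂ) * Complex.exp (I * F x)‖ ≤
      4 / m ^ 2 + 4 * K / m ^ 3 + (N₁ + 1 - N) * (K / m ^ 2) := by
  have hne : ∀ x ∈ Icc N (N₁ + 1), F' x ≠ 0 := fun x hx h0 => by
    have := hm' x hx; rw [h0, abs_zero] at this; linarith
  have hs1 : Icc N (N + 1) ⊆ Icc N (N₁ + 1) := Icc_subset_Icc le_rfl (by linarith)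
  have hs2 : Icc (N + 1) N₁ ⊆ Icc N (N₁ + 1) := Icc_subset_Icc (by linarith) (by linarith)
  have hs3 : Icc N₁ (N₁ + 1) ⊆ Icc N (N₁ + 1) := Icc_subset_Icc (by linarith) le_rfl
  rw [integral_trap_split hN hF,
    integral_affine_mul_exp_eq (α := 1) (β := -N) (by linarith) (fun x hx => hF x (hs1 hx))
      (fun x hx => hF' x (hs1 hx)) (hF''c.mono hs1) (fun x hx => hne x (hs1 hx)),
    integral_affine_mul_exp_eq (α := 0) (β := 1) hN (fun x hx => hF x (hs2 hx))
      (fun x hx => hF' x (hs2 hx)) (hF''c.mono hs2) (fun x hx => hne x (hs2 hx)),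
    integral_affine_mul_exp_eq (α := -1) (β := N₁ + 1) (by linarith) (fun x hx => hF x (hs3 hx))
      (fun x hx => hF' x (hs3 hx)) (hF''c.mono hs3) (fun x hx => hne x (hs3 hx))]
  -- the `E₂` pieces
  have hunit := norm_integral_exp_div_le (F := F) (le_of_lt (by linarith : N < N + 1)) (by linarith) hm
    (fun x hx => hF x (hs1 hx)) (fun x hx => hF' x (hs1 hx)) (hF''c.mono hs1)
    (fun x hx => hm' x (hs1 hx)) (fun x hx => hK x (hs1 hx))
  have hunit' := norm_integral_exp_div_le (F := F) (le_of_lt (by linarith : N₁ < N₁ + 1)) (by linarith) hm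
    (fun x hx => hF x (hs3 hx)) (fun x hx => hF' x (hs3 hx)) (hF''c.mono hs3)
    (fun x hx => hm' x (hs3 hx)) (fun x hx => hK x (hs3 hx))
  have e21 : ‖∫ x in N..(N + 1), ((1 : ℝ) : ℂ) * Complex.exp (I * F x) / (I * F' x)‖ ≤
      2 / m ^ 2 + 2 * K / m ^ 3 := by
    refine le_of_eq_of_le ?_ hunit
    congr 1
    refine intervalIntegral.integral_congr fun x _ => ?_
    push_cast; ring
  have e22 : ‖∫ x in (N + 1)..N₁, ((0 : ℝ) : ℂ) * Complex.exp (I * F x) / (I * F' x)‖ = 0 := by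
    rw [norm_eq_zero]
    have : (fun x : ℝ => ((0 : ℝ) : ℂ) * Complex.exp (I * F x) / (I * F' x)) = fun _ => 0 := by
      funext x; push_cast; ring
    rw [this, intervalIntegral.integral_zero]
  have e23 : ‖∫ x in N₁..(N₁ + 1), ((-1 : ℝ) : ℂ) * Complex.exp (I * F x) / (I * F' x)‖ ≤
      2 / m ^ 2 + 2 * K / m ^ 3 := by
    refine le_of_eq_of_le ?_ hunit'
    rw [← norm_neg]
    congr 1
    rw [← intervalIntegral.integral_neg]
    refine intervalIntegral.integral_congr fun x _ => ?_
    push_cast; ring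
  -- the `E₃` pieces
  have e31 := norm_integral_affine_second_le (F := F) (α := 1) (β := -N) (W := 1) (by linarith : N ≤ N + 1) hm
    (fun x hx => hm' x (hs1 hx)) (fun x hx => hK x (hs1 hx))
    (fun x hx => by rw [abs_le]; constructor <;> linarith [hx.1, hx.2])
  have e32 := norm_integral_affine_second_le (F := F) (α := 0) (β := 1) (W := 1) hN hm
    (fun x hx => hm' x (hs2 hx)) (fun x hx => hK x (hs2 hx)) (fun x hx => by norm_num)
  have e33 := norm_integral_affine_second_le (F := F) (α := -1) (β := N₁ + 1) (W := 1)
    (by linarith : N₁ ≤ N₁ + 1) hm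
    (fun x hx => hm' x (hs3 hx)) (fun x hx => hK x (hs3 hx))
    (fun x hx => by rw [abs_le]; constructor <;> linarith [hx.1, hx.2])
  -- the boundary terms cancel
  have hb : ((1 * (N + 1) + -N : ℝ) : ℂ) * Complex.exp (I * F (N + 1)) / (I * F' (N + 1))
      - ((1 * N + -N : ℝ) : ℂ) * Complex.exp (I * F N) / (I * F' N)
      + (((0 * N₁ + 1 : ℝ) : ℂ) * Complex.exp (I * F N₁) / (I * F' N₁)
      - ((0 * (N + 1) + 1 : ℝ) : ℂ) * Complex.exp (I * F (N + 1)) / (I * F' (N + 1)))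
      + (((-1 * (N₁ + 1) + (N₁ + 1) : ℝ) : ℂ) * Complex.exp (I * F (N₁ + 1)) / (I * F' (N₁ + 1))
      - ((-1 * N₁ + (N₁ + 1) : ℝ) : ℂ) * Complex.exp (I * F N₁) / (I * F' N₁)) = 0 := by
    push_cast; ring
  have key : ∀ (B₁ B₂ B₃ E₂₁ E₂₂ E₂₃ E₃₁ E₃₂ E₃₃ : ℂ), B₁ + B₂ + B₃ = 0 →
      ‖(B₁ - E₂₁ + E₃₁) + (B₂ - E₂₂ + E₃₂) + (B₃ - E₂₃ + E₃₃)‖ ≤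
        ‖E₂₁‖ + ‖E₂₂‖ + ‖E₂₃‖ + ‖E₃₁‖ + ‖E₃₂‖ + ‖E₃₃‖ := by
    intro B₁ B₂ B₃ E₂₁ E₂₂ E₂₃ E₃₁ E₃₂ E₃₃ h
    have : (B₁ - E₂₁ + E₃₁) + (B₂ - E₂₂ + E₃₂) + (B₃ - E₂₃ + E₃₃) =
        (E₃₁ + E₃₂ + E₃₃) - (E₂₁ + E₂₂ + E₂₃) := by linear_combination h
    rw [this]
    refine (norm_sub_le _ _).trans ?_
    have h1 := norm_add₃_le (a := E₃₁) (b := E₃₂) (c := E₃₃)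
    have h2 := norm_add₃_le (a := E₂₁) (b := E₂₂) (c := E₂₃)
    linarith
  refine (key _ _ _ _ _ _ _ _ _ hb).trans ?_
  have hK0 : 0 ≤ K := (abs_nonneg _).trans (hK N (left_mem_Icc.2 (by linarith)))
  have hKm : 0 ≤ K / m ^ 2 := by positivity
  have htot : (N + 1 - N) * (1 * K / m ^ 2) + (N₁ - (N + 1)) * (1 * K / m ^ 2) + (N₁ + 1 - N₁) * (1 * K / m ^ 2)
      = (N₁ + 1 - N) * (K / m ^ 2) := by ring
  have c1 : (4 : ℝ) / m ^ 2 = 2 * (2 / m ^ 2) := by ring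
  have c2 : (4 : ℝ) * K / m ^ 3 = 2 * (2 * K / m ^ 3) := by ring
  linarith [e21, e22, e23, e31, e32, e33, htot, c1, c2]


/-! ### Specialisation to the cubic phase `e(μx³ - (h/c)x)`: Graham–Kolesnik's Lemmas 7.8 and 7.9 -/

section Cubic

variable {μ c N N₁ h : ℝ}

/-- The size of `φ' = 2π(3μx² - h/c)` on `[N, N₁ + 1]` away from the stationary range: if
`h ≤ 2μcN²` or `h ≥ 4μc(N₁ + 1)²` then `|φ'| ≥ π(μcN² + |h|)/(4c)`. [folklore] -/
theorem abs_phase'_ge (hμ : 0 < μ) (hc : 0 < c) (hN : 0 < N)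
    (hh : h ≤ 2 * μ * c * N ^ 2 ∨ 4 * μ * c * (N₁ + 1) ^ 2 ≤ h) {x : ℝ} (hx : x ∈ Icc N (N₁ + 1)) :
    π * (μ * c * N ^ 2 + |h|) / (4 * c) ≤ |2 * π * (3 * μ * x ^ 2 - h / c)| := by
  have hπ := Real.pi_pos
  have hx0 : 0 ≤ x := hN.le.trans hx.1
  rcases hh with hh | hh
  · -- `φ' ≥ 2π(3μN² - h/c) > 0`
    have hxN : N ^ 2 ≤ x ^ 2 := pow_le_pow_left₀ hN.le hx.1 2
    have hμc := mul_pos hμ hc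
    have hgap : μ * c * N ^ 2 ≤ 3 * μ * c * x ^ 2 - h := by
      nlinarith [mul_nonneg hμc.le (sub_nonneg.2 hxN)]
    have hposN : 0 < μ * c * N ^ 2 := by positivity
    have hpos : 0 < 3 * μ * x ^ 2 - h / c := by
      rw [sub_pos, div_lt_iff₀ hc]; nlinarith
    have hφpos : 0 < 2 * π * (3 * μ * x ^ 2 - h / c) := mul_pos (mul_pos two_pos hπ) hpos
    rw [abs_of_pos hφpos, div_le_iff₀ (by positivity)]
    -- `π(μcN² + |h|) ≤ 2π(3μx² - h/c)(4c) = 8π(3μcx² - h)`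
    have key : μ * c * N ^ 2 + |h| ≤ 8 * (3 * μ * c * x ^ 2 - h) := by
      rcases le_or_gt 0 h with h0 | h0
      · rw [abs_of_nonneg h0]; nlinarith
      · rw [abs_of_neg h0]; nlinarith
    have e : 2 * π * (3 * μ * x ^ 2 - h / c) * (4 * c) = π * (8 * (3 * μ * c * x ^ 2 - h)) := by
      field_simp; ring
    rw [e]
    exact mul_le_mul_of_nonneg_left key hπ.le
  · -- `φ' ≤ 2π(3μ(N₁+1)² - h/c) ≤ -πh/(2c) < 0`
    have hxN₁ : x ^ 2 ≤ (N₁ + 1) ^ 2 := pow_le_pow_left₀ hx0 hx.2 2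
    have hμc := mul_pos hμ hc
    have hN₁1 : 0 < N₁ + 1 := hN.trans_le (hx.1.trans hx.2)
    have hhpos : 0 < h :=
      lt_of_lt_of_le (mul_pos (mul_pos (mul_pos four_pos hμ) hc) (pow_pos hN₁1 2)) hh
    have hgap : 4 * μ * c * x ^ 2 ≤ h := le_trans (by nlinarith [mul_nonneg hμc.le (sub_nonneg.2 hxN₁)]) hh
    have hneg : 3 * μ * x ^ 2 - h / c < 0 := by
      rw [sub_neg, lt_div_iff₀ hc]; nlinarith [sq_nonneg x, mul_nonneg hμc.le (sq_nonneg x)]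
    have hφneg : 2 * π * (3 * μ * x ^ 2 - h / c) < 0 := mul_neg_of_pos_of_neg (mul_pos two_pos hπ) hneg
    rw [abs_of_neg hφneg, div_le_iff₀ (by positivity), abs_of_pos hhpos]
    have key : μ * c * N ^ 2 + h ≤ 8 * (h - 3 * μ * c * x ^ 2) := by
      have : N ^ 2 ≤ x ^ 2 := pow_le_pow_left₀ hN.le hx.1 2
      nlinarith [mul_nonneg hμc.le (sq_nonneg x), mul_nonneg hμc.le (sub_nonneg.2 this)]
    have e : -(2 * π * (3 * μ * x ^ 2 - h / c)) * (4 * c) = π * (8 * (h - 3 * μ * c * x ^ 2)) := by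
      field_simp; ring
    rw [e]
    exact mul_le_mul_of_nonneg_left key hπ.le

/-- **Graham–Kolesnik, Lemma 7.8 (variant), PROVED.** For `μ, c > 0`, `N > 0`, `N + 1 ≤ N₁` and
`h ≤ 2μcN²` or `h ≥ 4μc(N₁ + 1)²` (G–K print "`h < 2μcN²` or `h > 2μcN₁²`"; their Lemma 7.16 uses
the lemma for `h ∉ [2μcN², 4μcN₁²]`, and the thresholds only affect constants):
`‖∫ g(x) e(μx³ - hx/c) dx‖ ≤ 7c/(μcN² + |h|)`, the integral being over the support `[N, N₁ + 1]` of
the trapezoid `g`. [cite: GrahamKolesnik1991, Lemma 7.8] -/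
theorem GrahamKolesnik_lemma78 (hμ : 0 < μ) (hc : 0 < c) (hN : 0 < N) (hNN₁ : N + 1 ≤ N₁)
    (hh : h ≤ 2 * μ * c * N ^ 2 ∨ 4 * μ * c * (N₁ + 1) ^ 2 ≤ h) :
    ‖∫ x in N..(N₁ + 1), (trap N N₁ x : ℂ) * Complex.exp (2 * π * I * (μ * x ^ 3 - h / c * x : ℝ))‖
      ≤ 7 * c / (μ * c * N ^ 2 + |h|) := by
  have hint : (∫ x in N..(N₁ + 1), (trap N N₁ x : ℂ) * Complex.exp (2 * π * I * (μ * x ^ 3 - h / c * x : ℝ)))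
      = ∫ x in N..(N₁ + 1), (trap N N₁ x : ℂ) * Complex.exp (I * (2 * π * (μ * x ^ 3 - h / c * x) : ℝ)) :=
    intervalIntegral.integral_congr fun x _ => by rw [e_cubic_eq]
  rw [hint]
  have hD : 0 < μ * c * N ^ 2 + |h| := by positivity
  set m : ℝ := π * (μ * c * N ^ 2 + |h|) / (4 * c) with hm
  have hm0 : 0 < m := by positivity
  have h1 := norm_integral_trap_le (F := fun x => 2 * π * (μ * x ^ 3 - h / c * x))
    (F' := fun x => 2 * π * (3 * μ * x ^ 2 - h / c)) (F'' := fun x => 12 * π * μ * x) hNN₁ hm0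
    (fun x _ => hasDerivAt_phase μ h c x) (fun x _ => hasDerivAt_phase' μ h c x)
    (Continuous.continuousOn (by fun_prop))
    (Or.inl fun x hx => by have : 0 ≤ x := hN.le.trans hx.1; positivity)
    (fun x hx => abs_phase'_ge hμ hc hN hh hx)
  refine h1.trans ?_
  rw [hm, div_div_eq_mul_div, div_le_div_iff₀ (by positivity) hD]
  nlinarith [Real.pi_gt_three, mul_pos hc hD]
set_option maxHeartbeats 400000 in -- buildfix (bf3-g27): 160k/180k FAIL, 200k PASS at accept time; line-neutral budget line
/-- **Graham–Kolesnik, Lemma 7.9 (variant), PROVED.** For `μ, c > 0`, `1 ≤ N`, `N + 1 ≤ N₁ ≤ 2N` and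
`|h| ≥ 4μc(N₁ + 1)²` (G–K: `|h| > 4μcN₁²`):
`‖∫ g(x) e(μx³ - hx/c) dx‖ ≤ 100 (1 + μN²) c²/h²`. [cite: GrahamKolesnik1991, Lemma 7.9] -/
theorem GrahamKolesnik_lemma79 (hμ : 0 < μ) (hc : 0 < c) (hN : 1 ≤ N) (hNN₁ : N + 1 ≤ N₁) (hN₁ : N₁ ≤ 2 * N)
    (hh : 4 * μ * c * (N₁ + 1) ^ 2 ≤ |h|) :
    ‖∫ x in N..(N₁ + 1), (trap N N₁ x : ℂ) * Complex.exp (2 * π * I * (μ * x ^ 3 - h / c * x : ℝ))‖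
      ≤ 100 * (1 + μ * N ^ 2) * c ^ 2 / h ^ 2 := by
  have hint : (∫ x in N..(N₁ + 1), (trap N N₁ x : ℂ) * Complex.exp (2 * π * I * (μ * x ^ 3 - h / c * x : ℝ)))
      = ∫ x in N..(N₁ + 1), (trap N N₁ x : ℂ) * Complex.exp (I * (2 * π * (μ * x ^ 3 - h / c * x) : ℝ)) :=
    intervalIntegral.integral_congr fun x _ => by rw [e_cubic_eq]
  rw [hint]
  have hπ := Real.pi_pos
  have hπ3 := Real.pi_gt_three
  have hN0 : 0 < N := by linarith
  have hN₁1 : 0 < N₁ + 1 := by linarith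
  have hhpos : 0 < |h| :=
    lt_of_lt_of_le (mul_pos (mul_pos (mul_pos four_pos hμ) hc) (pow_pos hN₁1 2)) hh
  have hh0 : h ≠ 0 := abs_pos.1 hhpos
  set m : ℝ := π * |h| / (2 * c) with hm
  have hm0 : 0 < m := by positivity
  set K : ℝ := 36 * π * μ * N with hK
  -- `|φ'| ≥ m`
  have hm' : ∀ x ∈ Icc N (N₁ + 1), m ≤ |2 * π * (3 * μ * x ^ 2 - h / c)| := by
    intro x hx
    have hx0 : 0 ≤ x := hN0.le.trans hx.1
    have hμc := mul_pos hμ hc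
    have hxN₁ : x ^ 2 ≤ (N₁ + 1) ^ 2 := pow_le_pow_left₀ hx0 hx.2 2
    rw [hm]
    rcases le_or_gt 0 h with h0 | h0
    · rw [abs_of_nonneg h0] at hh ⊢
      have hgap : 4 * μ * c * x ^ 2 ≤ h :=
        le_trans (by nlinarith [mul_nonneg hμc.le (sub_nonneg.2 hxN₁)]) hh
      have hx0' : 0 < x := hN0.trans_le hx.1
      have hneg : 3 * μ * x ^ 2 - h / c < 0 := by
        rw [sub_neg, lt_div_iff₀ hc]
        have := mul_pos hμc (pow_pos hx0' 2)
        nlinarith [hgap]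
      have hφneg : 2 * π * (3 * μ * x ^ 2 - h / c) < 0 := mul_neg_of_pos_of_neg (mul_pos two_pos hπ) hneg
      rw [abs_of_neg hφneg, div_le_iff₀ (by positivity)]
      have key : h ≤ 4 * (h - 3 * μ * c * x ^ 2) := by nlinarith
      have e : -(2 * π * (3 * μ * x ^ 2 - h / c)) * (2 * c) = π * (4 * (h - 3 * μ * c * x ^ 2)) := by
        field_simp; ring
      rw [e]; exact mul_le_mul_of_nonneg_left key hπ.le
    · rw [abs_of_neg h0]
      have hpos : 0 < 3 * μ * x ^ 2 - h / c := by
        have h1 : 0 ≤ 3 * μ * x ^ 2 := by positivity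
        have h2 : h / c < 0 := div_neg_of_neg_of_pos h0 hc
        linarith
      have hφpos : 0 < 2 * π * (3 * μ * x ^ 2 - h / c) := mul_pos (mul_pos two_pos hπ) hpos
      rw [abs_of_pos hφpos, div_le_iff₀ (by positivity)]
      have key : -h ≤ 4 * (3 * μ * c * x ^ 2 - h) := by
        nlinarith [mul_nonneg hμc.le (sq_nonneg x)]
      have e : 2 * π * (3 * μ * x ^ 2 - h / c) * (2 * c) = π * (4 * (3 * μ * c * x ^ 2 - h)) := by
        field_simp; ring
      rw [e]; exact mul_le_mul_of_nonneg_left key hπ.le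
  -- `|φ''| ≤ K`
  have hK' : ∀ x ∈ Icc N (N₁ + 1), |12 * π * μ * x| ≤ K := by
    intro x hx
    have hx0 : 0 ≤ x := hN0.le.trans hx.1
    rw [abs_of_nonneg (by positivity), hK]
    have : x ≤ 3 * N := by linarith [hx.2]
    nlinarith [mul_pos hπ hμ]
  have h1 := norm_integral_trap_le₂ (F := fun x => 2 * π * (μ * x ^ 3 - h / c * x))
    (F' := fun x => 2 * π * (3 * μ * x ^ 2 - h / c)) (F'' := fun x => 12 * π * μ * x) hNN₁ hm0
    (fun x _ => hasDerivAt_phase μ h c x) (fun x _ => hasDerivAt_phase' μ h c x)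
    (Continuous.continuousOn (by fun_prop)) hm' hK'
  refine h1.trans ?_
  -- the three terms
  have hsq : |h| ^ 2 = h ^ 2 := sq_abs h
  have hm2 : m ^ 2 = π ^ 2 * h ^ 2 / (4 * c ^ 2) := by
    rw [hm, ← hsq]; field_simp; ring
  have hm3 : m ^ 3 = π ^ 3 * |h| ^ 3 / (8 * c ^ 3) := by
    rw [hm]; field_simp; ring
  have hch : μ * N * c ≤ |h| / 4 := by
    have : N * 1 ≤ (N₁ + 1) ^ 2 := by nlinarith
    nlinarith [mul_pos hμ hc]
  have t1 : 4 / m ^ 2 ≤ 2 * (c ^ 2 / h ^ 2) := by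
    rw [hm2, div_le_iff₀ (by positivity)]
    have e : 2 * (c ^ 2 / h ^ 2) * (π ^ 2 * h ^ 2 / (4 * c ^ 2)) = π ^ 2 / 2 := by
      field_simp; norm_num
    rw [e]; nlinarith
  have t2 : 4 * K / m ^ 3 ≤ 32 * (c ^ 2 / h ^ 2) := by
    rw [hm3, hK, div_le_iff₀ (by positivity)]
    -- `4·36πμN·8c³ ≤ 32 (c²/h²) π³ |h|³ = 32 π³ c² |h|` using `μNc ≤ |h|/4` and `π² > 9`
    have e : 32 * (c ^ 2 / h ^ 2) * (π ^ 3 * |h| ^ 3 / (8 * c ^ 3)) = 4 * π ^ 3 * |h| / c := by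
      rw [← hsq]; field_simp; ring
    rw [e, le_div_iff₀ hc]
    have hπ2 : 9 < π ^ 2 := by nlinarith
    have h36 : 36 * μ * N * c ≤ π ^ 2 * |h| := by
      nlinarith [hch, mul_le_mul_of_nonneg_right hπ2.le hhpos.le]
    have h4π : 0 ≤ 4 * π := by positivity
    nlinarith [mul_le_mul_of_nonneg_left h36 h4π]
  have t3 : (N₁ + 1 - N) * (K / m ^ 2) ≤ 96 * μ * N ^ 2 * (c ^ 2 / h ^ 2) := by
    rw [hm2, hK]
    have hlen : N₁ + 1 - N ≤ 2 * N := by linarith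
    have e : 36 * π * μ * N / (π ^ 2 * h ^ 2 / (4 * c ^ 2)) = (144 / π) * (μ * N) * (c ^ 2 / h ^ 2) := by
      field_simp; ring
    rw [e]
    have h48 : 144 / π ≤ 48 := by rw [div_le_iff₀ hπ]; linarith
    have hc2' : 0 ≤ c ^ 2 / h ^ 2 := by positivity
    have hμN : 0 ≤ μ * N := by positivity
    calc (N₁ + 1 - N) * (144 / π * (μ * N) * (c ^ 2 / h ^ 2))
        ≤ (2 * N) * (48 * (μ * N) * (c ^ 2 / h ^ 2)) := by
          refine mul_le_mul hlen ?_ (by positivity) (by positivity)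
          exact mul_le_mul_of_nonneg_right (mul_le_mul_of_nonneg_right h48 hμN) hc2'
      _ = 96 * μ * N ^ 2 * (c ^ 2 / h ^ 2) := by ring
  have hc2 : 0 ≤ c ^ 2 / h ^ 2 := by positivity
  have hY : 0 ≤ μ * N ^ 2 * (c ^ 2 / h ^ 2) := by positivity
  have e1 : 96 * μ * N ^ 2 * (c ^ 2 / h ^ 2) = 96 * (μ * N ^ 2 * (c ^ 2 / h ^ 2)) := by ring
  have e2 : 100 * (1 + μ * N ^ 2) * c ^ 2 / h ^ 2 =
      100 * (c ^ 2 / h ^ 2) + 100 * (μ * N ^ 2 * (c ^ 2 / h ^ 2)) := by ring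
  rw [e2]
  rw [e1] at t3
  linarith [t1, t2, t3, hc2, hY]

end Cubic

end AiryHardy

end Literature.Analysis.Fourier
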